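import Summits.ResolutionOfSingularities.ResolutionOfSingularities.Theorems.FrobeniusLadderFInjectiveMacaulayficationF108ToricCones

/-!
# [OURS · L1 W4.5a · F-108 toric infrastructure 6/7] The vertex charts cover: a ray-shooting Minkowski–Weyl for the polyhedron of the
# support function

For a state `S` with `Inv S`, the polyhedron `P = {u : ⟨ρ, u⟩ ≥ ⟨ρ, m_d⟩ for every ray ρ of every cone d}` of the support function has
the vertices `m_d` and recession cone the orthant: ★ `Inv.mw` — every rational point `u` of `P` dominates a convex combination of the
vertices, `u ≥ Σ μ_d m_d`, `μ ≥ 0`, `Σ μ = 1` (proof: the rays tight at `u` are rays of one cone `d₀` — by strict concavity and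
completeness applied to their sum —, and shooting from `m_{d₀}` through `u` either never leaves `P` (then `u ≥ m_{d₀}`) or exits at a point
with more tight rays); ★ `Inv.mw_int` — the integral form `D·u ≥ Σ μ̂_d m_d`, `Σ μ̂ = D ≥ 1`, which is the Rees-algebra cover certificate
`x^u·t ∈ √(x^{m_d}·t : d)` used for `hcov` of `F108Consumable`.  No polyhedral library is used.
AI-written; weaker than expert review. Nothing here proves resolution of singularities in positive characteristic.
-/

set_option linter.dupNamespace false

noncomputable section

namespace Summit.ResolutionOfSingularities.ResolutionOfSingularities.Theorems.FInjectiveMacaulayfication.F108Toric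

open Matrix Finset

variable {n : ℕ}

/-- The rational pairing of an integral vector with a rational vector. [OURS · bookkeeping] -/
def qdot (v : Fin n → ℤ) (u : Fin n → ℚ) : ℚ := ∑ j, (v j : ℚ) * u j

/-- `qdot` against an integral vector is the cast of the dot product. -/
theorem qdot_cast (v w : Fin n → ℤ) : qdot v (fun j => (w j : ℚ)) = ((v ⬝ᵥ w : ℤ) : ℚ) := by
  simp [qdot, dotProduct]

/-- Additivity of `qdot` in the integral argument. -/
theorem qdot_add_left (v v' : Fin n → ℤ) (u : Fin n → ℚ) : qdot (v + v') u = qdot v u + qdot v' u := by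
  simp [qdot, add_mul, sum_add_distrib]

/-- Homogeneity of `qdot` in the integral argument. -/
theorem qdot_smul_left (c : ℤ) (v : Fin n → ℤ) (u : Fin n → ℚ) : qdot (c • v) u = (c : ℚ) * qdot v u := by
  simp [qdot, mul_assoc, mul_sum]

/-- `qdot` of a finite sum of integral vectors. -/
theorem qdot_sum_left {ι : Type*} (s : Finset ι) (f : ι → Fin n → ℤ) (u : Fin n → ℚ) :
    qdot (∑ x ∈ s, f x) u = ∑ x ∈ s, qdot (f x) u := by
  classical
  induction s using Finset.induction_on with
  | empty => simp [qdot]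
  | insert a s ha ih => rw [sum_insert ha, sum_insert ha, qdot_add_left, ih]

/-- Additivity of `qdot` in the rational argument. -/
theorem qdot_add_right (v : Fin n → ℤ) (u u' : Fin n → ℚ) : qdot v (u + u') = qdot v u + qdot v u' := by
  simp [qdot, mul_add, sum_add_distrib]

/-- Homogeneity of `qdot` in the rational argument. -/
theorem qdot_smul_right (v : Fin n → ℤ) (t : ℚ) (u : Fin n → ℚ) : qdot v (t • u) = t * qdot v u := by
  simp [qdot, mul_sum, mul_left_comm]

/-- `qdot` of `u − cast m`. -/
theorem qdot_sub_cast (v : Fin n → ℤ) (u : Fin n → ℚ) (m : Fin n → ℤ) :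
    qdot v (u - fun j => (m j : ℚ)) = qdot v u - ((v ⬝ᵥ m : ℤ) : ℚ) := by
  rw [← qdot_cast, sub_eq_add_neg, qdot_add_right]
  simp [qdot, sum_neg_distrib]
  ring

/-- `qdot e_j u = u j`. -/
theorem qdot_single (j : Fin n) (u : Fin n → ℚ) : qdot (Pi.single j 1) u = u j := by
  classical
  simp [qdot, Pi.single_apply]

section mw

variable {S : Finset (DCone n)} (hS : Inv S)
include hS

/-- ★ RAY-SHOOTING MINKOWSKI–WEYL: a rational point of the polyhedron of the support function dominates a convex combination of the
vertices `m_d`. -/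
theorem Inv.mw : ∀ u : Fin n → ℚ, (∀ d ∈ S, ∀ i, ((d.ray i ⬝ᵥ d.m : ℤ) : ℚ) ≤ qdot (d.ray i) u) →
    ∃ μ : DCone n → ℚ, (∀ d, 0 ≤ μ d) ∧ ∑ d ∈ S, μ d = 1 ∧ ∀ j, ∑ d ∈ S, μ d * (d.m j : ℚ) ≤ u j := by
  classical
  -- induction on the number of non-tight (cone, slot) pairs
  suffices H : ∀ k : ℕ, ∀ u : Fin n → ℚ,
      ((S ×ˢ (univ : Finset (Fin n))).filter fun p => ¬ ((p.1.ray p.2 ⬝ᵥ p.1.m : ℤ) : ℚ) = qdot (p.1.ray p.2) u).card = k →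
      (∀ d ∈ S, ∀ i, ((d.ray i ⬝ᵥ d.m : ℤ) : ℚ) ≤ qdot (d.ray i) u) →
      ∃ μ : DCone n → ℚ, (∀ d, 0 ≤ μ d) ∧ ∑ d ∈ S, μ d = 1 ∧ ∀ j, ∑ d ∈ S, μ d * (d.m j : ℚ) ≤ u j from
    fun u hu => H _ u rfl hu
  intro k
  induction k using Nat.strong_induction_on with
  | _ k ih =>
  intro u hk hu
  -- the tight pairs and the cone carrying all tight rays
  set T := (S ×ˢ (univ : Finset (Fin n))).filter fun p => ((p.1.ray p.2 ⬝ᵥ p.1.m : ℤ) : ℚ) = qdot (p.1.ray p.2) u with hT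
  set w : Fin n → ℤ := ∑ p ∈ T, p.1.ray p.2 with hw
  have hw0 : ∀ j, 0 ≤ w j := fun j => by
    rw [hw, Finset.sum_apply]
    exact sum_nonneg fun p hp => hS.nonneg p.1 (mem_product.1 (mem_filter.1 hp).1).1 p.2 j
  obtain ⟨d₀, hd₀, c, hc, hwc⟩ := hS.complete w hw0
  have htight : ∀ p ∈ T, p.1.ray p.2 ∈ d₀.rays := by
    -- chain of (in)equalities, all equalities
    have h1 : ∀ p ∈ T, ((p.1.ray p.2 ⬝ᵥ p.1.m : ℤ) : ℚ) ≤ ((p.1.ray p.2 ⬝ᵥ d₀.m : ℤ) : ℚ) := by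
      intro p hp
      have hp1 : p.1 ∈ S := (mem_product.1 (mem_filter.1 hp).1).1
      have := hS.sc_nonneg hp1 hd₀ p.2
      rw [dotProduct_sub] at this
      exact_mod_cast (by linarith : p.1.ray p.2 ⬝ᵥ p.1.m ≤ p.1.ray p.2 ⬝ᵥ d₀.m)
    have h2 : ∑ p ∈ T, ((p.1.ray p.2 ⬝ᵥ d₀.m : ℤ) : ℚ) ≤ ∑ p ∈ T, ((p.1.ray p.2 ⬝ᵥ p.1.m : ℤ) : ℚ) := by
      calc ∑ p ∈ T, ((p.1.ray p.2 ⬝ᵥ d₀.m : ℤ) : ℚ) = ((w ⬝ᵥ d₀.m : ℤ) : ℚ) := by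
            rw [hw, sum_dotProduct']; push_cast; rfl
        _ = ∑ i, (c i : ℚ) * ((d₀.ray i ⬝ᵥ d₀.m : ℤ) : ℚ) := by
            rw [hwc, sum_dotProduct']; push_cast
            exact sum_congr rfl fun i _ => by rw [smul_dotProduct, smul_eq_mul]; push_cast; ring
        _ ≤ ∑ i, (c i : ℚ) * qdot (d₀.ray i) u :=
            sum_le_sum fun i _ => mul_le_mul_of_nonneg_left (hu d₀ hd₀ i) (by exact_mod_cast hc i)
        _ = qdot w u := by rw [hwc, qdot_sum_left]; exact sum_congr rfl fun i _ => by rw [qdot_smul_left]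
        _ = ∑ p ∈ T, qdot (p.1.ray p.2) u := by rw [hw, qdot_sum_left]
        _ = ∑ p ∈ T, ((p.1.ray p.2 ⬝ᵥ p.1.m : ℤ) : ℚ) := sum_congr rfl fun p hp => ((mem_filter.1 hp).2).symm
    have h3 : ∀ p ∈ T, ((p.1.ray p.2 ⬝ᵥ p.1.m : ℤ) : ℚ) = ((p.1.ray p.2 ⬝ᵥ d₀.m : ℤ) : ℚ) := by
      have := (sum_eq_sum_iff_of_le h1).1 (le_antisymm (sum_le_sum h1) h2)
      exact this
    intro p hp
    have hp1 : p.1 ∈ S := (mem_product.1 (mem_filter.1 hp).1).1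
    have h4 : p.1.ray p.2 ⬝ᵥ (d₀.m - p.1.m) = 0 := by
      rw [dotProduct_sub, sub_eq_zero]; exact_mod_cast (h3 p hp).symm
    exact (hS.sc p.1 hp1 d₀ hd₀ p.2).1 h4
  -- the shooting direction and its pairing with the rays
  set dv : Fin n → ℚ := u - fun j => (d₀.m j : ℚ) with hdv
  have hderiv_tight : ∀ p ∈ T, qdot (p.1.ray p.2) dv = 0 := by
    intro p hp
    have hp1 : p.1 ∈ S := (mem_product.1 (mem_filter.1 hp).1).1
    rw [hdv, qdot_sub_cast, ← (mem_filter.1 hp).2, hS.dot_m_eq_of_mem hp1 hd₀ (htight p hp), sub_self]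
  by_cases hA : ∀ p ∈ S ×ˢ (univ : Finset (Fin n)), 0 ≤ qdot (p.1.ray p.2) dv
  · -- the ray never leaves: `u ≥ m_{d₀}`
    refine ⟨fun d => if d = d₀ then 1 else 0, fun d => by dsimp only; split_ifs <;> norm_num,
      by rw [sum_ite_eq' S d₀, if_pos hd₀], fun j => ?_⟩
    have hsum : ∑ d ∈ S, (if d = d₀ then (1 : ℚ) else 0) * (d.m j : ℚ) = (d₀.m j : ℚ) := by
      simp_rw [boole_mul]; rw [sum_ite_eq', if_pos hd₀]
    rw [hsum]
    -- `dv j ≥ 0` from completeness at `e_j`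
    obtain ⟨d, hd, c', hc', he⟩ := hS.complete (Pi.single j 1) (fun k => by by_cases h : k = j <;> simp [h])
    have : 0 ≤ qdot (Pi.single j 1) dv := by
      rw [he, qdot_sum_left]
      exact sum_nonneg fun i _ => by
        rw [qdot_smul_left]; exact mul_nonneg (by exact_mod_cast hc' i) (hA (d, i) (mem_product.2 ⟨hd, mem_univ i⟩))
    rw [qdot_single, hdv] at this
    simpa using this
  · -- the ray exits: shoot to the first wall
    push Not at hA
    set Q := (S ×ˢ (univ : Finset (Fin n))).filter fun p => qdot (p.1.ray p.2) dv < 0 with hQ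
    have hQne : Q.Nonempty := by obtain ⟨p, hp, hlt⟩ := hA; exact ⟨p, mem_filter.2 ⟨hp, hlt⟩⟩
    -- slack / (−derivative)
    set tf : DCone n × Fin n → ℚ := fun p => (qdot (p.1.ray p.2) u - ((p.1.ray p.2 ⬝ᵥ p.1.m : ℤ) : ℚ)) / (- qdot (p.1.ray p.2) dv)
      with htf
    obtain ⟨p₀, hp₀Q, hmin⟩ := exists_min_image Q tf hQne
    obtain ⟨hp₀, hp₀lt⟩ := mem_filter.1 hp₀Q
    have hp₀S : p₀.1 ∈ S := (mem_product.1 hp₀).1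
    set t := tf p₀ with ht
    have hslack : ∀ p ∈ S ×ˢ (univ : Finset (Fin n)), 0 ≤ qdot (p.1.ray p.2) u - ((p.1.ray p.2 ⬝ᵥ p.1.m : ℤ) : ℚ) :=
      fun p hp => sub_nonneg.2 (hu p.1 (mem_product.1 hp).1 p.2)
    have hp₀nt : p₀ ∉ T := fun h => by have := hderiv_tight p₀ h; linarith
    have hslack₀ : 0 < qdot (p₀.1.ray p₀.2) u - ((p₀.1.ray p₀.2 ⬝ᵥ p₀.1.m : ℤ) : ℚ) := by
      rcases (hslack p₀ hp₀).lt_or_eq with h | h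
      · exact h
      · exfalso; apply hp₀nt; rw [hT, mem_filter]; exact ⟨hp₀, by linarith⟩
    have htpos : 0 < t := by rw [ht, htf]; exact div_pos hslack₀ (by linarith)
    set u₁ := u + t • dv with hu₁
    -- `u₁` is in the polyhedron
    have hu₁P : ∀ d ∈ S, ∀ i, ((d.ray i ⬝ᵥ d.m : ℤ) : ℚ) ≤ qdot (d.ray i) u₁ := by
      intro d hd i
      have hp : (d, i) ∈ S ×ˢ (univ : Finset (Fin n)) := mem_product.2 ⟨hd, mem_univ i⟩
      rw [hu₁, qdot_add_right, qdot_smul_right]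
      by_cases hneg : qdot (d.ray i) dv < 0
      · have hle : t ≤ tf (d, i) := hmin _ (mem_filter.2 ⟨hp, hneg⟩)
        rw [htf] at hle
        have := (le_div_iff₀ (by linarith : (0:ℚ) < -qdot (d.ray i) dv)).1 hle
        linarith
      · push Not at hneg
        have := hslack _ hp
        nlinarith
    -- strictly fewer non-tight pairs
    have hcard : ((S ×ˢ (univ : Finset (Fin n))).filter fun p =>
        ¬ ((p.1.ray p.2 ⬝ᵥ p.1.m : ℤ) : ℚ) = qdot (p.1.ray p.2) u₁).card < k := by
      rw [← hk]
      apply card_lt_card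
      rw [ssubset_iff_of_subset]
      · refine ⟨p₀, mem_filter.2 ⟨hp₀, fun h => hp₀nt ?_⟩, fun h => (mem_filter.1 h).2 ?_⟩
        · rw [hT, mem_filter]; exact ⟨hp₀, h⟩
        · have hδ : qdot (p₀.1.ray p₀.2) dv ≠ 0 := by linarith
          have hmul : t * qdot (p₀.1.ray p₀.2) dv = -(qdot (p₀.1.ray p₀.2) u - ((p₀.1.ray p₀.2 ⬝ᵥ p₀.1.m : ℤ) : ℚ)) := by
            rw [ht, htf]; dsimp only; field_simp
          rw [hu₁, qdot_add_right, qdot_smul_right, hmul]; ring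
      · intro p hp
        obtain ⟨hpS, hne⟩ := mem_filter.1 hp
        refine mem_filter.2 ⟨hpS, fun heq => hne ?_⟩
        -- tight for `u` ⇒ tight for `u₁`
        have hpT : p ∈ T := by rw [hT, mem_filter]; exact ⟨hpS, heq⟩
        rw [hu₁, qdot_add_right, qdot_smul_right, hderiv_tight p hpT, mul_zero, add_zero]; exact heq
    obtain ⟨μ₁, hμ₁0, hμ₁1, hμ₁u⟩ := ih _ hcard u₁ rfl hu₁P
    -- combine: `u = (u₁ + t·m_{d₀}) / (1 + t)`
    refine ⟨fun d => (μ₁ d + if d = d₀ then t else 0) / (1 + t), fun d => div_nonneg (by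
      have := hμ₁0 d; split_ifs <;> linarith) (by linarith), ?_, fun j => ?_⟩
    · rw [← sum_div, sum_add_distrib, hμ₁1, sum_ite_eq' S d₀, if_pos hd₀]; field_simp
    · have h1 := hμ₁u j
      have hsplit : ∑ d ∈ S, (μ₁ d + if d = d₀ then t else 0) / (1 + t) * (d.m j : ℚ)
          = (∑ d ∈ S, μ₁ d * (d.m j : ℚ) + t * (d₀.m j : ℚ)) / (1 + t) := by
        rw [add_div, sum_div]
        rw [show ∑ d ∈ S, (μ₁ d + if d = d₀ then t else 0) / (1 + t) * (d.m j : ℚ)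
            = ∑ d ∈ S, (μ₁ d * (d.m j : ℚ) / (1 + t) + (if d = d₀ then t else 0) * (d.m j : ℚ) / (1 + t)) from
          sum_congr rfl fun d _ => by ring]
        rw [sum_add_distrib, ← sum_div]
        congr 1
        rw [← sum_div]
        congr 1
        rw [← sum_filter_of_ne (p := fun d => d = d₀) fun d _ h => by by_contra hne; simp [hne] at h]
        rw [filter_eq' S d₀, if_pos hd₀, sum_singleton, if_pos rfl]
      rw [hsplit, div_le_iff₀ (by linarith : (0:ℚ) < 1 + t)]
      have hu₁j : u₁ j = u j + t * (u j - (d₀.m j : ℚ)) := by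
        rw [hu₁, hdv]; simp [Pi.add_apply, Pi.smul_apply, Pi.sub_apply, smul_eq_mul]
      nlinarith

/-- ★ INTEGRAL FORM: an integral point of the polyhedron of the support function satisfies `D·u ≥ Σ μ̂_d m_d` with `μ̂ ∈ ℕ`,
`Σ μ̂ = D ≥ 1` — the Rees-algebra cover certificate. -/
theorem Inv.mw_int (u : Fin n → ℤ) (hu : ∀ d ∈ S, ∀ i, d.ray i ⬝ᵥ d.m ≤ d.ray i ⬝ᵥ u) :
    ∃ D : ℕ, ∃ μ : DCone n → ℕ, 1 ≤ D ∧ ∑ d ∈ S, μ d = D ∧ ∀ j, ∑ d ∈ S, (μ d : ℤ) * d.m j ≤ (D : ℤ) * u j := by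
  classical
  obtain ⟨μ, hμ0, hμ1, hμu⟩ := hS.mw (fun j => (u j : ℚ)) (by
    intro d hd i; rw [qdot_cast]; exact_mod_cast hu d hd i)
  set D : ℕ := ∏ d ∈ S, (μ d).den with hD
  have hDpos : 0 < D := prod_pos fun d _ => (μ d).den_pos
  have hdvd : ∀ d ∈ S, (μ d).den ∣ D := fun d hd => dvd_prod_of_mem (fun d => (μ d).den) hd
  set ν : DCone n → ℕ := fun d => (μ d).num.toNat * (D / (μ d).den) with hν
  have hint : ∀ d ∈ S, ((ν d : ℕ) : ℚ) = μ d * D := by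
    intro d hd
    have hnum : 0 ≤ (μ d).num := Rat.num_nonneg.2 (hμ0 d)
    obtain ⟨k, hk⟩ := hdvd d hd
    rw [hν]; dsimp only
    rw [hk, Nat.mul_div_cancel_left _ (μ d).den_pos]
    push_cast
    have hcast : (((μ d).num.toNat : ℕ) : ℚ) = ((μ d).num : ℚ) := by
      rw [← Int.cast_natCast, Int.toNat_of_nonneg hnum]
    rw [hcast, ← Rat.mul_den_eq_num (μ d)]
    ring
  refine ⟨D, ν, hDpos, ?_, fun j => ?_⟩
  · have h : ((∑ d ∈ S, ν d : ℕ) : ℚ) = (D : ℚ) := by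
      push_cast
      rw [sum_congr rfl fun d hd => hint d hd, ← sum_mul, hμ1, one_mul]
    exact_mod_cast h
  · have h : ((∑ d ∈ S, (ν d : ℤ) * d.m j : ℤ) : ℚ) ≤ ((D : ℤ) * u j : ℤ) := by
      push_cast
      rw [sum_congr rfl fun d hd => by rw [hint d hd]]
      have := hμu j
      calc ∑ d ∈ S, μ d * (D : ℚ) * (d.m j : ℚ) = (D : ℚ) * ∑ d ∈ S, μ d * (d.m j : ℚ) := by
            rw [mul_sum]; exact sum_congr rfl fun d _ => by ring
        _ ≤ (D : ℚ) * (u j : ℚ) := mul_le_mul_of_nonneg_left this (by positivity)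
    exact_mod_cast h

end mw

end Summit.ResolutionOfSingularities.ResolutionOfSingularities.Theorems.FInjectiveMacaulayfication.F108Toric

end
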